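import Summits.ResolutionOfSingularities.ResolutionOfSingularities.Theses.Valuative
import Literature.AlgebraicGeometry.Resolution.LocalUniformization
import Literature.AlgebraicGeometry.Resolution.ResolutionLU

/-!
# `Valuative.LupiToLu` (stmt-ResolutionOfSingularities-0562): reductions

Route `ResolutionOfSingularities/Valuative`, support item `LupiToLu` (rank 4, superseded by the
relative items `TorsorToLurelFfinite` = stmt-0643 and `TorsorToLurel` = stmt-10968):

  `LupiToLu := ∀ p prime, LUPI_p → LU_p`,

where `LU_p` is ABSOLUTE (weak, Zariski 1940 / Knaf–Kuhlmann 2009 §1) local uniformization in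
characteristic `p` — every valuation ring `O ⊇ k` of a finitely generated `K/k`, `char k = p`,
contains SOME finitely generated `k`-subalgebra `A` with `Frac A = K` regular at the centre
`𝔪_O ∩ A` — and `LUPI_p` is the same statement restricted to the purely inseparable hypersurface
function fields `K = k(x₁, …, xₙ)(t)`, `t ^ p ∈ k[x]`.

This file records, sorry-free, how the item sits in the route (pure logic over the tree):

* `lupiToLu_of_localUniformizationInChar` — the consequent of `LupiToLu` at `p` IS
  `Literature.AlgebraicGeometry.Resolution.LocalUniformizationInChar.{0} p`; in particular
  `LU_p` for all primes gives `LupiToLu` (the antecedent `LUPI_p` is not used).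
* `lupiToLu_of_relLocalUniformization` — RELATIVE local uniformization `LUrel_p` (the first
  conjunct of the route target `ValuativeThesisRel`, stmt-0639) gives `LupiToLu`
  (`R := ⊥`, tree lemma `Literature.AlgGeom.localUniformization_of_rel`).
* `lupiToLu_of_luAlphaPTorsor_of_torsorToLurel` — the live crux chain of the route
  (`LuAlphaPTorsor` = stmt-0641, `TorsorToLurel` = stmt-10968) gives `LupiToLu`; this is the
  honest form of "Temkin's reduction" that the item's informal text describes.
* `lupiToLu_of_valuativeThesisRel` — the route target gives `LupiToLu`.
* `lupiToLu_of_resolutionOfSingularities` — the summit itself gives `LupiToLu`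
  (`ResolutionInChar.localUniformizationInChar`), so the item is sandwiched between the crux
  chain and the summit and has no independent failure mode.

What is deliberately NOT here: a proof of `LupiToLu` from its own antecedent. As typed the
antecedent is ABSOLUTE `LUPI_p` over polynomial rings `k[x]`; Temkin's tower
(arXiv:0804.1554v3 Rem. 1.3.5(ii)) `K₀ = k·L^{pⁿ} ⊂ K₁ ⊂ ⋯ ⊂ K_m = K`, `K_{i+1} = K_i(a_i^{1/p})`,
needs at every step local uniformization of the `α_p`-torsor `t ^ p = a_i` over a base that is
merely REGULAR at the centre (crux `LuAlphaPTorsor`), not over a polynomial ring: the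
intermediate fields `K_i` are not purely transcendental over any subfield of `O`. See the
evidence note attached to stmt-0562 for the full analysis (for perfect `k` and zero-dimensional
`O`, `LUPI_p` speaks exactly about the function fields `K ≅ K'` with
`k(y₁^p, …, y_d^p) ⊆ K' ⊆ k(y₁, …, y_d)`).
-/

-- `Summit.<S>.<S>.…` duplicates the summit name by design (D-0017, single-problem summit).
set_option linter.dupNamespace false

namespace Summit.ResolutionOfSingularities.ResolutionOfSingularities.Theorems

open Summit.ResolutionOfSingularities.ResolutionOfSingularities.Theses.Valuative
open Literature.AlgebraicGeometry.Resolution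

/-- `LU_p` for every prime `p` — stated as the tree predicate
`Literature.AlgebraicGeometry.Resolution.LocalUniformizationInChar.{0} p`, which is the consequent
of `LupiToLu` at `p` up to unfolding `IsLocallyUniformizable` — gives `LupiToLu`; the hypothesis
`LUPI_p` of the item is discarded. [folklore] -/
theorem lupiToLu_of_localUniformizationInChar
    (h : ∀ p : ℕ, p.Prime → LocalUniformizationInChar.{0} p) : LupiToLu := by
  intro p hp _hlupi k K _ _ _ _ hK O hO
  exact h p hp k K hK O hO

/-- RELATIVE local uniformization in characteristic `p` for every prime `p` (`LUrel_p`: every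
finitely generated `R ⊆ O` is dominated by a finitely generated `A ⊆ O`, `Frac A = K`, regular at
the centre — the first conjunct of the route target `ValuativeThesisRel`, stmt-0639) gives
`LupiToLu`: take `R := ⊥` (`Literature.AlgGeom.localUniformization_of_rel`). [folklore] -/
theorem lupiToLu_of_relLocalUniformization
    (h : ∀ p : ℕ, p.Prime → ∀ (k K : Type) [Field k] [CharP k p] [Field K] [Algebra k K],
      (⊤ : IntermediateField k K).FG → ∀ O : ValuationSubring K, (∀ c : k, algebraMap k K c ∈ O) →
      ∀ R : Subalgebra k K, R.FG → R.toSubring ≤ O.toSubring →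
      ∃ (A : Subalgebra k K) (h : A.toSubring ≤ O.toSubring), R ≤ A ∧ A.FG ∧ IsFractionRing A K ∧
        IsRegularLocalRing (Localization.AtPrime
          (Ideal.comap (Subring.inclusion h) (IsLocalRing.maximalIdeal O)))) :
    LupiToLu := by
  intro p hp _hlupi
  exact Literature.AlgGeom.localUniformization_of_rel p (h p hp)

/-- The live crux chain of route `Valuative` gives `LupiToLu`: local uniformization of
`α_p`-torsors `t ^ p = a` over bases regular at the centre (crux `LuAlphaPTorsor`, stmt-0641)
and Temkin's inseparable reduction in its relative form (`TorsorToLurel`, stmt-10968) yield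
`LUrel_p`, hence `LU_p`, hence the item. This is the correctly typed version of the reduction
"LUPI → LU" (Temkin 2013, arXiv:0804.1554v3, Thm. 1.3.2 + Rem. 1.3.5(ii)) that the item's informal
description intends. [folklore] -/
theorem lupiToLu_of_luAlphaPTorsor_of_torsorToLurel (h₂ : LuAlphaPTorsor) (h₄ : TorsorToLurel) :
    LupiToLu :=
  lupiToLu_of_relLocalUniformization fun p hp => h₄ p hp (h₂ p hp)

/-- The route target `ValuativeThesisRel` (stmt-0639: `∀ p prime, LUrel_p ∧ (LUrel_p → Res_p)`)
gives `LupiToLu` (first conjunct, `R := ⊥`). [folklore] -/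
theorem lupiToLu_of_valuativeThesisRel (h : ValuativeThesisRel) : LupiToLu :=
  lupiToLu_of_relLocalUniformization fun p hp => (h p hp).1

/-- Faithfulness: the summit `ResolutionOfSingularities` (resolution in every prime
characteristic) gives `LupiToLu`, through `Res_p → LU_p`
(`Literature.AlgebraicGeometry.Resolution.ResolutionInChar.localUniformizationInChar`: resolve an
affine model, take the chart of the centre via the valuative criterion). So `LupiToLu` is implied
by the summit and cannot fail unless resolution fails in some characteristic `p`. [folklore] -/
theorem lupiToLu_of_resolutionOfSingularities (h : _root_.ResolutionOfSingularities) : LupiToLu :=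
  lupiToLu_of_localUniformizationInChar fun p hp =>
    ResolutionInChar.localUniformizationInChar (h p hp)

end Summit.ResolutionOfSingularities.ResolutionOfSingularities.Theorems

/-!
## As typed, `LupiToLu` is absolute `LU_p` modulo its own antecedent (added 2026-08-16)

The two declarations below make the verdict of four prover seats (stmt-0562, 2026-08-16)
kernel-visible: modulo the route's own antecedent item `Lupi` (stmt-0560, absolute `LUPI_p` for
every prime — itself open for `n ≥ 4` and superseded by the crux `LuAlphaPTorsor`), the item
`LupiToLu` is EQUIVALENT to absolute local uniformization in every prime characteristic,
`∀ p prime, Literature.AlgebraicGeometry.Resolution.LocalUniformizationInChar.{0} p`. So a proof of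
the item as typed is, in the presence of `Lupi`, exactly a proof of `LU_p` for all `p` (open in
transcendence degree `≥ 4`), and a refutation of it is a counterexample to `LU_p`; the honest,
independently meaningful form of "Temkin's reduction" is the relative item `TorsorToLurel`
(stmt-10968), see `lupiToLu_of_luAlphaPTorsor_of_torsorToLurel` above.
-/

namespace Summit.ResolutionOfSingularities.ResolutionOfSingularities.Theorems

open Summit.ResolutionOfSingularities.ResolutionOfSingularities.Theses.Valuative
open Literature.AlgebraicGeometry.Resolution

/-- Modus ponens inside the route: `LupiToLu` (stmt-0562: `∀ p prime, LUPI_p → LU_p`) together with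
its antecedent item `Lupi` (stmt-0560: `∀ p prime, LUPI_p`) gives absolute local uniformization
`LU_p = Literature.AlgebraicGeometry.Resolution.LocalUniformizationInChar.{0} p` for every prime `p`
(the consequent of `LupiToLu` at `p` is that predicate up to unfolding `IsLocallyUniformizable`).
[folklore] -/
theorem localUniformizationInChar_of_lupiToLu_of_lupi (h : LupiToLu) (hL : Lupi)
    (p : ℕ) (hp : p.Prime) : LocalUniformizationInChar.{0} p := by
  intro k K _ _ _ _ hK O hO
  exact h p hp (hL p hp) k K hK O hO

/-- **`LupiToLu` as typed is `LU_p` modulo `Lupi`.** Given the route's antecedent item `Lupi`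
(stmt-0560, absolute `LUPI_p` for every prime `p`), the item `LupiToLu` (stmt-0562) is equivalent to
absolute local uniformization in every prime characteristic,
`∀ p prime, Literature.AlgebraicGeometry.Resolution.LocalUniformizationInChar.{0} p` — open for
`trdeg K/k ≥ 4` (Temkin 2013 = arXiv:0804.1554 §1 (ii): "the case of dim(X) > 3 is widely open").
`→` is `localUniformizationInChar_of_lupiToLu_of_lupi`; `←` is
`lupiToLu_of_localUniformizationInChar` (which does not even use `Lupi`). [folklore] -/
theorem lupiToLu_iff_localUniformizationInChar_of_lupi (hL : Lupi) :
    LupiToLu ↔ ∀ p : ℕ, p.Prime → LocalUniformizationInChar.{0} p :=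
  ⟨fun h => localUniformizationInChar_of_lupiToLu_of_lupi h hL,
    lupiToLu_of_localUniformizationInChar⟩

end Summit.ResolutionOfSingularities.ResolutionOfSingularities.Theorems
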